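import Literature.MathematicalPhysics.QuantumLattice.TwoClusterFock
import HarnessLib

/-!
# Fermionic product states over an ordered partition into clusters (Koszul-signed tensor product)

`TwoClusterFock` treats two clusters placed one BELOW the other (`ι ⊕ₗ ι`). In a lattice the
orbitals of different clusters (e.g. the `2 × 2` plaquettes of the checkerboard Hubbard torus in the
`Lex` site order) are INTERLEAVED, and the occupation-basis product of cluster amplitudes is no
longer the CAR-algebra product state: reordering the creation operators of
`P_{c₁}† P_{c₂}† ⋯ |0⟩` (clusters in increasing order) into the increasing orbital order of the basis
vector `|s⟩` costs the **Koszul sign** `(-1)^{inv(s)}`, `inv(s)` = number of pairs of occupied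
orbitals `x < y` lying in clusters `cl y < cl x` (Bultinck–Williamson–Haegeman–Verstraete 2017
§III–IV.A: the reordering isomorphism `ℱ` of fermionic tensor networks; Bratteli–Robinson II §5.2.2:
the CAR algebra of a direct sum is the graded tensor product). This file sets up, for an ORDERED
PARTITION of a finite orbital set `ι'` into clusters `c : C` each order-isomorphic to `κ`
(`ClusterProduct.Partition`):

* `part P c s` (the cluster-`c` part of a configuration), `crossInv P s`, `koszul P s = (-1)^{inv(s)}`,
  and the product state `prodFamily P ψ (s) = koszul P s · Π_c ψ c (part P c s)`;
* the environment of a cluster and gluing (`env_emb_eq_filter`, `part_combine_of_ne`);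
* **the sign identity** `koszul_combine_mul_koszul_combine`: for a fixed environment `r` of cluster
  `c₀` and two image parts `w, w'`,
  `koszul(w ⊔ r) · koszul(w' ⊔ r) = (-1)^{(#w + #w') · #r_{<c₀}} · transSign (emb c₀) r (w Δ w')`
  — the Koszul signs reproduce exactly the Jordan–Wigner environment signs of `FermionEmbedding`;
* hence **even cluster operators act on their own factor**:
  `jwEmbed (P.emb c₀) a (⊗_c ψ_c) = ⊗_c (update ψ c₀ (a ψ_{c₀}))_c` for parity-preserving `a`
  (`jwEmbed_mulVec_prodFamily`), with NO condition on the other factors; and **odd cluster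
  operators** (`IsParityReversing`: `c_i`, `c†_i`) act on their factor and twist every LOWER factor
  by its parity operator `P = (-1)^N` (`jwEmbed_mulVec_prodFamily_of_parityReversing`,
  `annihilation_emb_mulVec_prodFamily`, `creation_emb_mulVec_prodFamily`) — the Jordan–Wigner string
  through the lower clusters;
* inner products factor (`star_prodFamily_dotProduct_prodFamily`), sizes and parities add
  (`card_eq_sum_card_part`, `hasParity_prodFamily`), configurations ↔ families of parts
  (`configEquiv`).

References: O. Bratteli, D. W. Robinson, *Operator Algebras and QSM II* (1997) §5.2.2
[BratteliRobinsonII1997]; N. Bultinck, D. J. Williamson, J. Haegeman, F. Verstraete, PRB 95 (2017)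
075108, §III–IV.A [BultinckWilliamsonHaegemanVerstraete2017fMPS]. Tree: `JWEmbed.pre/env/combine/rangeF/envSign/transSign`,
`transSign_mul_transSign`, `pre_combine`, `disjoint_env_rangeF` (`FermionEmbedding`);
`TwoCluster.jwEmbed_mulVec_apply`, `TwoCluster.IsParityPreserving` (`TwoClusterFock`).
-/

noncomputable section

namespace Literature.MathematicalPhysics.QuantumLattice

open Matrix Finset JWEmbed TwoCluster
open scoped symmDiff

namespace ClusterProduct

/-- An **ordered partition of the orbital set `ι'` into clusters** `c : C`, each order-isomorphic to
`κ`: order embeddings `emb c : κ ↪o ι'` together with the inverse coordinates `cl x` (the cluster of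
an orbital) and `idx x` (its position in the cluster). The order on `C` is the order in which the
cluster factors are multiplied. [folklore] -/
structure Partition (ι' C κ : Type*) [LinearOrder ι'] [LinearOrder κ] where
  /-- the cluster embeddings -/
  emb : C → κ ↪o ι'
  /-- the cluster of an orbital -/
  cl : ι' → C
  /-- the position of an orbital inside its cluster -/
  idx : ι' → κ
  /-- every orbital is the `idx`-th orbital of its cluster -/
  emb_cl_idx : ∀ x, emb (cl x) (idx x) = x
  /-- `cl` inverts the embeddings -/
  cl_emb : ∀ c i, cl (emb c i) = c
  /-- `idx` inverts the embeddings -/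
  idx_emb : ∀ c i, idx (emb c i) = i

variable {ι' C κ : Type*} [LinearOrder ι'] [LinearOrder C] [LinearOrder κ]

namespace Partition

variable (P : Partition ι' C κ)

omit [LinearOrder C] in
/-- Orbitals of different clusters differ. [folklore] -/
theorem emb_ne_emb_of_ne {c c' : C} (h : c ≠ c') (i j : κ) : P.emb c i ≠ P.emb c' j := by
  intro h'
  apply h
  rw [← P.cl_emb c i, h', P.cl_emb]

omit [LinearOrder C] in
/-- An orbital lies in the image of cluster `c` iff its cluster is `c`. [folklore] -/
theorem mem_rangeF_iff [Fintype κ] (c : C) (x : ι') : x ∈ rangeF (P.emb c) ↔ P.cl x = c := by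
  rw [mem_rangeF]
  constructor
  · rintro ⟨i, rfl⟩
    exact P.cl_emb c i
  · intro h
    exact ⟨P.idx x, by rw [← h, P.emb_cl_idx]⟩

/-- The cluster-`c` part of a configuration. [folklore] -/
def part (c : C) (s : Finset ι') : Finset κ := pre (P.emb c) s

omit [LinearOrder C] in
/-- Membership in a part. [folklore] -/
@[simp] theorem mem_part {c : C} {s : Finset ι'} {i : κ} : i ∈ P.part c s ↔ P.emb c i ∈ s := mem_pre

/-- The **environment of cluster `c₀`** in a configuration: its orbitals in the other clusters.
[folklore] -/
theorem env_emb_eq_filter [Fintype κ] (c₀ : C) (u : Finset ι') :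
    env (P.emb c₀) u = u.filter (fun y => P.cl y ≠ c₀) := by
  ext y
  rw [mem_env, Finset.mem_filter, P.mem_rangeF_iff]

/-- Environment orbitals lie in other clusters. [folklore] -/
theorem cl_ne_of_mem_env [Fintype κ] {c₀ : C} {u : Finset ι'} {y : ι'} (hy : y ∈ env (P.emb c₀) u) :
    P.cl y ≠ c₀ := by
  rw [P.env_emb_eq_filter] at hy
  exact (Finset.mem_filter.1 hy).2

omit [LinearOrder C] in
/-- Gluing a new cluster-`c₀` part onto the environment does not change the other parts.
[folklore] -/
theorem part_combine_of_ne [Fintype κ] {c c₀ : C} (h : c ≠ c₀) (w : Finset κ) (u : Finset ι') :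
    P.part c (combine (P.emb c₀) w (env (P.emb c₀) u)) = P.part c u := by
  ext i
  rw [mem_part, mem_combine, mem_part]
  constructor
  · rintro (⟨i', -, h'⟩ | h')
    · exact absurd h' (P.emb_ne_emb_of_ne (Ne.symm h) i' i)
    · exact (mem_env.1 h').1
  · intro hi
    refine Or.inr (mem_env.2 ⟨hi, fun hr => ?_⟩)
    rw [P.mem_rangeF_iff, P.cl_emb] at hr
    exact h hr

omit [LinearOrder C] in
/-- The new cluster-`c₀` part of a glued configuration. [folklore] -/
theorem part_combine_self [Fintype κ] (c₀ : C) (w : Finset κ) (u : Finset ι') :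
    P.part c₀ (combine (P.emb c₀) w (env (P.emb c₀) u)) = w :=
  pre_combine (disjoint_env_rangeF u) w

/-! ### Cross-cluster inversions and the Koszul sign -/

/-- The number of **cross-cluster inversions** of a configuration: pairs of occupied orbitals
`x < y` whose clusters are in the opposite order, `cl y < cl x`. [cite: BultinckWilliamsonHaegemanVerstraete2017fMPS, §III] -/
def crossInv (s : Finset ι') : ℕ :=
  ((s ×ˢ s).filter (fun p => p.1 < p.2 ∧ P.cl p.2 < P.cl p.1)).card

/-- The **Koszul sign** `(-1)^{inv(s)}` of a configuration: the sign of the permutation sorting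
the cluster-ordered word of its creation operators into increasing orbital order.
[cite: BultinckWilliamsonHaegemanVerstraete2017fMPS, §III] -/
def koszul (s : Finset ι') : ℂ := (-1) ^ P.crossInv s

/-- Koszul signs are `±1`. [folklore] -/
theorem koszul_mul_self (s : Finset ι') : P.koszul s * P.koszul s = 1 := by
  rw [koszul, ← pow_add, ← two_mul, pow_mul]
  norm_num

/-- Koszul signs are real. [folklore] -/
theorem star_koszul (s : Finset ι') : star (P.koszul s) = P.koszul s := by
  simp [koszul]

/-- The contribution of one cluster-`c₀` orbital `emb c₀ i` to the cross inversions with an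
environment `r`: environment orbitals ABOVE it in LOWER clusters plus those BELOW it in HIGHER
clusters. [folklore] -/
def crossDeg (c₀ : C) (r : Finset ι') (i : κ) : ℕ :=
  (r.filter (fun y => P.emb c₀ i < y ∧ P.cl y < c₀)).card +
    (r.filter (fun y => y < P.emb c₀ i ∧ c₀ < P.cl y)).card

/-- **Decomposition of the cross inversions of a glued configuration**: pairs inside the
environment, plus the contributions of the cluster-`c₀` orbitals (no inversions inside one
cluster). [folklore] -/
theorem crossInv_combine (c₀ : C) (w : Finset κ) {r : Finset ι'} (hr : ∀ y ∈ r, P.cl y ≠ c₀) :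
    P.crossInv (combine (P.emb c₀) w r) = P.crossInv r + ∑ i ∈ w, P.crossDeg c₀ r i := by
  classical
  set W : Finset ι' := w.map (P.emb c₀).toEmbedding with hW
  have hdisj : Disjoint W r := by
    rw [Finset.disjoint_left]
    intro x hx hxr
    obtain ⟨i, -, rfl⟩ := Finset.mem_map.1 hx
    exact hr _ hxr (P.cl_emb c₀ i)
  have hcomb : combine (P.emb c₀) w r = W ∪ r := rfl
  unfold crossInv
  rw [hcomb]
  -- the predicate
  set Q : ι' × ι' → Prop := fun p => p.1 < p.2 ∧ P.cl p.2 < P.cl p.1 with hQ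
  -- split the product of the union
  have hsplit : ((W ∪ r) ×ˢ (W ∪ r)).filter Q =
      (W ×ˢ W).filter Q ∪ (W ×ˢ r).filter Q ∪ (r ×ˢ W).filter Q ∪ (r ×ˢ r).filter Q := by
    rw [Finset.union_product, Finset.product_union, Finset.product_union, Finset.filter_union,
      Finset.filter_union, Finset.filter_union]
    ac_rfl
  -- no inversions inside the cluster
  have hWW : (W ×ˢ W).filter Q = ∅ := by
    rw [Finset.filter_eq_empty_iff]
    rintro ⟨x, y⟩ hxy ⟨-, hcl⟩
    rw [Finset.mem_product] at hxy
    obtain ⟨i, -, rfl⟩ := Finset.mem_map.1 hxy.1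
    obtain ⟨j, -, rfl⟩ := Finset.mem_map.1 hxy.2
    simp [P.cl_emb] at hcl
  -- pairwise disjointness of the pieces
  have hd1 : Disjoint ((W ×ˢ r).filter Q) ((r ×ˢ W).filter Q) := by
    rw [Finset.disjoint_left]
    rintro ⟨x, y⟩ h1 h2
    have hx : x ∈ W := (Finset.mem_product.1 (Finset.mem_filter.1 h1).1).1
    have hx' : x ∈ r := (Finset.mem_product.1 (Finset.mem_filter.1 h2).1).1
    exact Finset.disjoint_left.1 hdisj hx hx'
  have hd2 : Disjoint ((W ×ˢ r).filter Q ∪ (r ×ˢ W).filter Q) ((r ×ˢ r).filter Q) := by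
    rw [Finset.disjoint_left]
    rintro ⟨x, y⟩ h1 h2
    have hxy : x ∈ r ∧ y ∈ r := Finset.mem_product.1 (Finset.mem_filter.1 h2).1
    rcases Finset.mem_union.1 h1 with h1 | h1
    · exact Finset.disjoint_left.1 hdisj (Finset.mem_product.1 (Finset.mem_filter.1 h1).1).1 hxy.1
    · exact Finset.disjoint_left.1 hdisj (Finset.mem_product.1 (Finset.mem_filter.1 h1).1).2 hxy.2
  -- the two cross pieces, orbital by orbital
  have hWr : ((W ×ˢ r).filter Q).card = ∑ i ∈ w, (r.filter (fun y => P.emb c₀ i < y ∧ P.cl y < c₀)).card := by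
    rw [Finset.card_filter, Finset.sum_product, hW, Finset.sum_map]
    refine Finset.sum_congr rfl fun i _ => ?_
    rw [Finset.card_filter]
    refine Finset.sum_congr rfl fun y _ => ?_
    simp [P.cl_emb]
  have hrW : ((r ×ˢ W).filter Q).card = ∑ i ∈ w, (r.filter (fun y => y < P.emb c₀ i ∧ c₀ < P.cl y)).card := by
    rw [Finset.card_filter, Finset.sum_product, Finset.sum_comm, hW, Finset.sum_map]
    refine Finset.sum_congr rfl fun i _ => ?_
    rw [Finset.card_filter]
    refine Finset.sum_congr rfl fun y _ => ?_
    simp [P.cl_emb]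
  rw [hsplit, hWW, Finset.empty_union, Finset.card_union_of_disjoint hd2,
    Finset.card_union_of_disjoint hd1, hWr, hrW]
  unfold crossDeg
  rw [Finset.sum_add_distrib]
  ring

/-- **Parity of the one-orbital contribution**: modulo 2, the cross degree of `emb c₀ i` against an
environment `r` is `#r_{<c₀} + #{y ∈ r : y < emb c₀ i}` — the second term is the exponent of the
Jordan–Wigner environment sign `envSign`. (Stated in `ℕ` with the doubly counted set added on the
left.) [folklore] -/
theorem crossDeg_add (c₀ : C) {r : Finset ι'} (hr : ∀ y ∈ r, P.cl y ≠ c₀) (i : κ) :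
    P.crossDeg c₀ r i + 2 * (r.filter (fun y => y < P.emb c₀ i ∧ P.cl y < c₀)).card =
      (r.filter (fun y => P.cl y < c₀)).card + (r.filter (· < P.emb c₀ i)).card := by
  classical
  -- `{cl < c₀} = {emb i < y ∧ cl < c₀} ⊔ {y < emb i ∧ cl < c₀}` (no `y = emb i` in `r`)
  have h1 : (r.filter (fun y => P.cl y < c₀)).card =
      (r.filter (fun y => P.emb c₀ i < y ∧ P.cl y < c₀)).card +
        (r.filter (fun y => y < P.emb c₀ i ∧ P.cl y < c₀)).card := by
    rw [← Finset.card_union_of_disjoint]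
    · congr 1
      ext y
      simp only [Finset.mem_filter, Finset.mem_union]
      constructor
      · rintro ⟨hy, hcl⟩
        have hne : y ≠ P.emb c₀ i := fun h => hr y hy (by rw [h, P.cl_emb])
        rcases lt_or_gt_of_ne hne with h | h
        · exact Or.inr ⟨hy, h, hcl⟩
        · exact Or.inl ⟨hy, h, hcl⟩
      · rintro (⟨hy, -, hcl⟩ | ⟨hy, -, hcl⟩) <;> exact ⟨hy, hcl⟩
    · rw [Finset.disjoint_left]
      intro y hy hy'
      exact lt_asymm (Finset.mem_filter.1 hy).2.1 (Finset.mem_filter.1 hy').2.1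
  -- `{y < emb i} = {y < emb i ∧ cl < c₀} ⊔ {y < emb i ∧ c₀ < cl}` (no `cl y = c₀` in `r`)
  have h2 : (r.filter (· < P.emb c₀ i)).card =
      (r.filter (fun y => y < P.emb c₀ i ∧ P.cl y < c₀)).card +
        (r.filter (fun y => y < P.emb c₀ i ∧ c₀ < P.cl y)).card := by
    rw [← Finset.card_union_of_disjoint]
    · congr 1
      ext y
      simp only [Finset.mem_filter, Finset.mem_union]
      constructor
      · rintro ⟨hy, hlt⟩
        rcases lt_or_gt_of_ne (hr y hy) with h | h
        · exact Or.inl ⟨hy, hlt, h⟩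
        · exact Or.inr ⟨hy, hlt, h⟩
      · rintro (⟨hy, hlt, -⟩ | ⟨hy, hlt, -⟩) <;> exact ⟨hy, hlt⟩
    · rw [Finset.disjoint_left]
      intro y hy hy'
      exact lt_asymm (Finset.mem_filter.1 hy).2.2 (Finset.mem_filter.1 hy').2.2
  unfold crossDeg
  omega

/-- **The sign of one cluster orbital**: `(-1)^{crossDeg} = (-1)^{#r_{<c₀}} · envSign (emb c₀) r i`.
[folklore] -/
theorem neg_one_pow_crossDeg (c₀ : C) {r : Finset ι'} (hr : ∀ y ∈ r, P.cl y ≠ c₀) (i : κ) :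
    ((-1 : ℂ) ^ P.crossDeg c₀ r i) =
      (-1) ^ (r.filter (fun y => P.cl y < c₀)).card * envSign (P.emb c₀) r i := by
  have h := P.crossDeg_add c₀ hr i
  have key : ((-1 : ℂ) ^ P.crossDeg c₀ r i) =
      (-1) ^ (P.crossDeg c₀ r i + 2 * (r.filter (fun y => y < P.emb c₀ i ∧ P.cl y < c₀)).card) := by
    rw [pow_add, pow_mul]
    norm_num
  rw [key, h, pow_add, envSign]

/-- **THE SIGN IDENTITY.** For a fixed environment `r` of cluster `c₀` and two cluster parts
`w, w'`: `koszul(w ⊔ r) · koszul(w' ⊔ r) = (-1)^{(#w + #w')·#r_{<c₀}} · transSign (emb c₀) r (w Δ w')`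
— the Koszul signs of the product state reproduce the Jordan–Wigner environment signs of the
second-quantised cluster operators. [cite: BultinckWilliamsonHaegemanVerstraete2017fMPS, §IV.A] -/
theorem koszul_combine_mul_koszul_combine (c₀ : C) (w w' : Finset κ) {r : Finset ι'}
    (hr : ∀ y ∈ r, P.cl y ≠ c₀) :
    P.koszul (combine (P.emb c₀) w r) * P.koszul (combine (P.emb c₀) w' r) =
      (-1) ^ ((w.card + w'.card) * (r.filter (fun y => P.cl y < c₀)).card) *
        transSign (P.emb c₀) r (w ∆ w') := by
  have hprod : ∀ v : Finset κ, ((-1 : ℂ) ^ ∑ i ∈ v, P.crossDeg c₀ r i) =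
      (-1) ^ (v.card * (r.filter (fun y => P.cl y < c₀)).card) * transSign (P.emb c₀) r v := by
    intro v
    rw [← Finset.prod_pow_eq_pow_sum, Finset.prod_congr rfl fun i _ => P.neg_one_pow_crossDeg c₀ hr i,
      Finset.prod_mul_distrib, Finset.prod_const, ← pow_mul, transSign, mul_comm v.card]
  rw [koszul, koszul, P.crossInv_combine c₀ w hr, P.crossInv_combine c₀ w' hr, pow_add, pow_add,
    hprod, hprod, ← transSign_mul_transSign]
  have hsq : ((-1 : ℂ) ^ P.crossInv r) * (-1) ^ P.crossInv r = 1 := by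
    rw [← pow_add, ← two_mul, pow_mul]; norm_num
  rw [add_mul, pow_add]
  linear_combination ((-1 : ℂ) ^ (w.card * (r.filter (fun y => P.cl y < c₀)).card) *
    transSign (P.emb c₀) r w * ((-1) ^ (w'.card * (r.filter (fun y => P.cl y < c₀)).card) *
      transSign (P.emb c₀) r w')) * hsq


/-! ### Configurations ↔ families of cluster configurations -/

/-- Reassemble a configuration from its cluster parts. [folklore] -/
def assemble [Fintype C] [Fintype κ] (f : C → Finset κ) : Finset ι' :=
  Finset.univ.biUnion fun c => (f c).map (P.emb c).toEmbedding

omit [LinearOrder C] in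
/-- Membership in a reassembled configuration. [folklore] -/
theorem mem_assemble [Fintype C] [Fintype κ] {f : C → Finset κ} {x : ι'} :
    x ∈ P.assemble f ↔ P.idx x ∈ f (P.cl x) := by
  rw [assemble, Finset.mem_biUnion]
  constructor
  · rintro ⟨c, -, hx⟩
    obtain ⟨i, hi, rfl⟩ := Finset.mem_map.1 hx
    simpa [P.cl_emb, P.idx_emb] using hi
  · intro h
    refine ⟨P.cl x, Finset.mem_univ _, Finset.mem_map.2 ⟨P.idx x, h, ?_⟩⟩
    exact P.emb_cl_idx x

omit [LinearOrder C] in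
/-- **Configurations of `ι'` ↔ families of cluster configurations.** [folklore] -/
def configEquiv [Fintype C] [Fintype κ] : Finset ι' ≃ (C → Finset κ) where
  toFun s c := P.part c s
  invFun f := P.assemble f
  left_inv s := by
    ext x
    rw [mem_assemble, mem_part, P.emb_cl_idx]
  right_inv f := by
    funext c
    ext i
    rw [mem_part, mem_assemble, P.idx_emb, P.cl_emb]

/-! ### Product states -/

/-- The **fermionic product state** of a family of cluster vectors: the Koszul-signed product of
the cluster amplitudes, `(⊗_c ψ_c)(s) = (-1)^{inv(s)} Π_c ψ_c(s_c)` — for even cluster vectors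
the CAR-algebra state `P_{c₁}† P_{c₂}† ⋯ |0⟩` (clusters in increasing order).
[cite: BultinckWilliamsonHaegemanVerstraete2017fMPS, §IV.A] -/
def prodFamily [Fintype C] (ψ : C → Fock κ) : Fock ι' :=
  fun s => P.koszul s * ∏ c, ψ c (P.part c s)

/-- Entries of a product state (definitional). [folklore] -/
theorem prodFamily_apply [Fintype C] (ψ : C → Fock κ) (s : Finset ι') :
    P.prodFamily ψ s = P.koszul s * ∏ c, ψ c (P.part c s) := rfl

/-- **Inner products of product states factor**: `⟨⊗ ψ'_c, ⊗ ψ_c⟩ = Π_c ⟨ψ'_c, ψ_c⟩` (the Koszul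
signs square to one). [folklore] -/
theorem star_prodFamily_dotProduct_prodFamily [Fintype ι'] [Fintype C] [Fintype κ]
    (ψ' ψ : C → Fock κ) :
    star (P.prodFamily ψ') ⬝ᵥ P.prodFamily ψ = ∏ c, (star (ψ' c) ⬝ᵥ ψ c) := by
  classical
  have hterm : ∀ s : Finset ι', star (P.prodFamily ψ' s) * P.prodFamily ψ s =
      ∏ c, (star (ψ' c (P.part c s)) * ψ c (P.part c s)) := by
    intro s
    rw [prodFamily_apply, prodFamily_apply, star_mul', star_prod, P.star_koszul, Finset.prod_mul_distrib]
    calc P.koszul s * (∏ c, star (ψ' c (P.part c s))) * (P.koszul s * ∏ c, ψ c (P.part c s))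
        = (P.koszul s * P.koszul s) * ((∏ c, star (ψ' c (P.part c s))) * ∏ c, ψ c (P.part c s)) := by ring
      _ = (∏ c, star (ψ' c (P.part c s))) * ∏ c, ψ c (P.part c s) := by rw [P.koszul_mul_self, one_mul]
  simp only [dotProduct, Pi.star_apply, hterm]
  -- reindex configurations by families of parts and factor the sum
  rw [← (P.configEquiv).symm.sum_comp]
  rw [Finset.prod_univ_sum (fun _ : C => (Finset.univ : Finset (Finset κ)))
    (fun c w => star (ψ' c w) * ψ c w), Fintype.piFinset_univ]
  refine Finset.sum_congr rfl fun f _ => Finset.prod_congr rfl fun c _ => ?_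
  have h : P.part c (P.configEquiv.symm f) = f c := congrFun (P.configEquiv.apply_symm_apply f) c
  rw [h]

/-- **An even cluster operator acts on its own factor**: for a parity-preserving operator `a` of
cluster `c₀`, `jwEmbed (emb c₀) a (⊗_c ψ_c) = ⊗_c ψ̃_c` with `ψ̃_{c₀} = a ψ_{c₀}` and `ψ̃_c = ψ_c`
otherwise — the Jordan–Wigner environment signs of the embedded operator are exactly compensated by
the Koszul signs (`koszul_combine_mul_koszul_combine`), with no condition on the other factors.
[cite: BultinckWilliamsonHaegemanVerstraete2017fMPS, §IV.A] -/
theorem jwEmbed_mulVec_prodFamily [Fintype ι'] [Fintype C] [Fintype κ] [DecidableEq C]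
    {a : Matrix (Finset κ) (Finset κ) ℂ} (ha : IsParityPreserving a) (c₀ : C) (ψ : C → Fock κ) :
    jwEmbed (P.emb c₀) a *ᵥ P.prodFamily ψ = P.prodFamily (Function.update ψ c₀ (a *ᵥ ψ c₀)) := by
  funext u
  have hr : ∀ y ∈ env (P.emb c₀) u, P.cl y ≠ c₀ := fun y hy => P.cl_ne_of_mem_env hy
  have hu : combine (P.emb c₀) (pre (P.emb c₀) u) (env (P.emb c₀) u) = u := combine_pre_env u
  set rest : ℂ := ∏ c ∈ Finset.univ.erase c₀, ψ c (P.part c u) with hrest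
  -- the product state at a configuration glued from `w` and the environment of `u`
  have hΨ : ∀ w : Finset κ, P.prodFamily ψ (combine (P.emb c₀) w (env (P.emb c₀) u)) =
      P.koszul (combine (P.emb c₀) w (env (P.emb c₀) u)) * (ψ c₀ w * rest) := by
    intro w
    rw [prodFamily_apply, ← Finset.mul_prod_erase _ _ (Finset.mem_univ c₀), P.part_combine_self]
    congr 2
    exact Finset.prod_congr rfl fun c hc => by rw [P.part_combine_of_ne (Finset.ne_of_mem_erase hc)]
  -- termwise: the environment sign cancels against the Koszul signs
  have hterm : ∀ w : Finset κ,
      a (pre (P.emb c₀) u) w * transSign (P.emb c₀) (env (P.emb c₀) u) (pre (P.emb c₀) u ∆ w) *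
          P.prodFamily ψ (combine (P.emb c₀) w (env (P.emb c₀) u)) =
        P.koszul u * (a (pre (P.emb c₀) u) w * ψ c₀ w) * rest := by
    intro w
    by_cases h0 : a (pre (P.emb c₀) u) w = 0
    · rw [h0]; ring
    · have hpar : (pre (P.emb c₀) u).card % 2 = w.card % 2 := ha _ _ h0
      have heven : Even (((pre (P.emb c₀) u).card + w.card) *
          ((env (P.emb c₀) u).filter (fun y => P.cl y < c₀)).card) := by
        refine Even.mul_right ?_ _
        rw [Nat.even_add, Nat.even_iff, Nat.even_iff, hpar]
      have hsign := P.koszul_combine_mul_koszul_combine c₀ (pre (P.emb c₀) u) w hr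
      rw [hu, heven.neg_one_pow, one_mul] at hsign
      -- `koszul (w ⊔ env) = koszul u · transSign`
      have hk : P.koszul (combine (P.emb c₀) w (env (P.emb c₀) u)) =
          P.koszul u * transSign (P.emb c₀) (env (P.emb c₀) u) (pre (P.emb c₀) u ∆ w) := by
        rw [← hsign, ← mul_assoc, P.koszul_mul_self, one_mul]
      have ht : transSign (P.emb c₀) (env (P.emb c₀) u) (pre (P.emb c₀) u ∆ w) *
          transSign (P.emb c₀) (env (P.emb c₀) u) (pre (P.emb c₀) u ∆ w) = 1 := by
        rw [transSign_mul_transSign, symmDiff_self, Finset.bot_eq_empty, transSign_empty]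
      rw [hΨ, hk]
      linear_combination (P.koszul u * a (pre (P.emb c₀) u) w * ψ c₀ w * rest) * ht
  rw [TwoCluster.jwEmbed_mulVec_apply, Finset.sum_congr rfl fun w _ => hterm w, ← Finset.sum_mul,
    ← Finset.mul_sum]
  -- the right-hand side
  rw [prodFamily_apply, ← Finset.mul_prod_erase _ _ (Finset.mem_univ c₀), Function.update_self]
  have hrest' : ∏ c ∈ Finset.univ.erase c₀, Function.update ψ c₀ (a *ᵥ ψ c₀) c (P.part c u) = rest :=
    Finset.prod_congr rfl fun c hc => by rw [Function.update_of_ne (Finset.ne_of_mem_erase hc)]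
  rw [hrest', mul_assoc]
  rfl

/-! ### Counting orbitals cluster by cluster; parity of product states -/

omit [LinearOrder C] in
/-- The orbitals of a configuration lying in a given set of clusters, counted cluster by cluster.
[folklore] -/
theorem card_filter_cl [Fintype C] [Fintype κ] (Q : C → Prop) [DecidablePred Q] (u : Finset ι') :
    (u.filter (fun y => Q (P.cl y))).card = ∑ c ∈ Finset.univ.filter Q, (P.part c u).card := by
  have hset : u.filter (fun y => Q (P.cl y)) =
      (Finset.univ.filter Q).biUnion (fun c => (P.part c u).map (P.emb c).toEmbedding) := by
    ext y
    simp only [Finset.mem_filter, Finset.mem_biUnion, Finset.mem_univ, true_and, Finset.mem_map,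
      mem_part, RelEmbedding.coe_toEmbedding]
    constructor
    · rintro ⟨hy, hQ⟩
      exact ⟨P.cl y, hQ, P.idx y, by rw [P.emb_cl_idx]; exact hy, P.emb_cl_idx y⟩
    · rintro ⟨c, hQ, i, hi, rfl⟩
      exact ⟨hi, by rwa [P.cl_emb]⟩
  rw [hset, Finset.card_biUnion]
  · exact Finset.sum_congr rfl fun c _ => Finset.card_map _
  · intro c _ c' _ hcc'
    rw [Function.onFun, Finset.disjoint_left]
    intro y hy hy'
    obtain ⟨i, -, rfl⟩ := Finset.mem_map.1 hy
    obtain ⟨j, -, h⟩ := Finset.mem_map.1 hy'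
    exact P.emb_ne_emb_of_ne (Ne.symm hcc') j i h

omit [LinearOrder C] in
/-- The size of a configuration is the sum of the sizes of its cluster parts. [folklore] -/
theorem card_eq_sum_card_part [Fintype C] [Fintype κ] (u : Finset ι') :
    u.card = ∑ c, (P.part c u).card := by
  have h := P.card_filter_cl (fun _ => True) u
  simp only [Finset.filter_true_of_mem (fun _ _ => trivial)] at h
  exact h

/-- The number of environment orbitals of cluster `c₀` in LOWER clusters, cluster by cluster.
[folklore] -/
theorem card_env_filter_lt [Fintype C] [Fintype κ] (c₀ : C) (u : Finset ι') :
    ((env (P.emb c₀) u).filter (fun y => P.cl y < c₀)).card =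
      ∑ c ∈ Finset.univ.filter (· < c₀), (P.part c u).card := by
  rw [← P.card_filter_cl (· < c₀) u, P.env_emb_eq_filter, Finset.filter_filter]
  congr 1
  exact Finset.filter_congr fun y _ => ⟨fun h => h.2, fun h => ⟨ne_of_lt h, h⟩⟩

/-- **Parity of a product state**: if every factor has a definite parity, the product state has the
sum of the parities. [folklore] -/
theorem hasParity_prodFamily [Fintype C] [Fintype κ] {p : C → ℕ} {ψ : C → Fock κ}
    (hψ : ∀ c, HasParity (p c) (ψ c)) : HasParity (∑ c, p c) (P.prodFamily ψ) := by
  intro s hs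
  rw [prodFamily_apply] at hs
  have hne : ∀ c, ψ c (P.part c s) ≠ 0 := fun c h0 =>
    hs (mul_eq_zero_of_right _ (Finset.prod_eq_zero (Finset.mem_univ c) h0))
  rw [P.card_eq_sum_card_part, Finset.sum_nat_mod, Finset.sum_congr rfl fun c _ => hψ c _ (hne c),
    ← Finset.sum_nat_mod]

/-! ### Odd cluster operators: the cluster-parity string -/

omit [LinearOrder C] in
/-- An operator on a fermionic Fock space is **parity reversing** (odd) if its entries between
configurations of equal parity vanish — e.g. a single creation or annihilation operator.
[folklore] -/
def _root_.Literature.MathematicalPhysics.QuantumLattice.TwoCluster.IsParityReversing {α : Type*}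
    (a : Matrix (Finset α) (Finset α) ℂ) : Prop :=
  ∀ s t, a s t ≠ 0 → (s.card + t.card) % 2 = 1

omit [LinearOrder C] in
/-- An annihilation operator is odd. [folklore] -/
theorem isParityReversing_annihilation (i : κ) : IsParityReversing (annihilation i) := by
  intro s t h
  rw [annihilation_apply] at h
  by_cases hc : i ∉ s ∧ t = insert i s
  · rw [hc.2, Finset.card_insert_of_notMem hc.1]; omega
  · rw [if_neg hc] at h; exact absurd rfl h

omit [LinearOrder C] in
/-- A creation operator is odd. [folklore] -/
theorem isParityReversing_creation (i : κ) : IsParityReversing (creation i) := by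
  intro t s h
  rw [creation_apply] at h
  by_cases hc : i ∉ s ∧ t = insert i s
  · rw [hc.2, Finset.card_insert_of_notMem hc.1]; omega
  · rw [if_neg hc] at h; exact absurd rfl h

/-- **An odd cluster operator acts on its own factor and twists the LOWER factors by their parity**:
for a parity-reversing operator `a` of cluster `c₀` (e.g. `c_i`, `c†_i`),
`jwEmbed (emb c₀) a (⊗_c ψ_c) = ⊗_c ψ̃_c` with `ψ̃_c = P ψ_c` for `c < c₀`, `ψ̃_{c₀} = a ψ_{c₀}`,
`ψ̃_c = ψ_c` for `c > c₀` (`P = parityOp = (-1)^N`) — the Jordan–Wigner string through the lower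
clusters. In particular `c_{emb c₀ i} (⊗ ψ) = (⊗_{c<c₀} P ψ_c) ⊗ (c_i ψ_{c₀}) ⊗ (⊗_{c>c₀} ψ_c)`
(Bratteli–Robinson II §5.2.2, eq. (5.2.13), for a partition into clusters).
[cite: BratteliRobinsonII1997, §5.2.2 eq. (5.2.13)] -/
theorem jwEmbed_mulVec_prodFamily_of_parityReversing [Fintype ι'] [Fintype C] [Fintype κ]
    [DecidableEq C] {a : Matrix (Finset κ) (Finset κ) ℂ} (ha : IsParityReversing a) (c₀ : C)
    (ψ : C → Fock κ) :
    jwEmbed (P.emb c₀) a *ᵥ P.prodFamily ψ =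
      P.prodFamily (fun c => if c < c₀ then parityOp *ᵥ ψ c else Function.update ψ c₀ (a *ᵥ ψ c₀) c) := by
  funext u
  have hr : ∀ y ∈ env (P.emb c₀) u, P.cl y ≠ c₀ := fun y hy => P.cl_ne_of_mem_env hy
  have hu : combine (P.emb c₀) (pre (P.emb c₀) u) (env (P.emb c₀) u) = u := combine_pre_env u
  set n : ℕ := ((env (P.emb c₀) u).filter (fun y => P.cl y < c₀)).card with hn
  set rest : ℂ := ∏ c ∈ Finset.univ.erase c₀, ψ c (P.part c u) with hrest
  -- the string: `(-1)^n = Π_{c < c₀} (-1)^{#u_c}`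
  have hstring : ((-1 : ℂ) ^ n) * rest =
      ∏ c ∈ Finset.univ.erase c₀, (fun c => if c < c₀ then parityOp *ᵥ ψ c else
        Function.update ψ c₀ (a *ᵥ ψ c₀) c) c (P.part c u) := by
    have hfac : ∀ c ∈ Finset.univ.erase c₀, (fun c => if c < c₀ then parityOp *ᵥ ψ c else
        Function.update ψ c₀ (a *ᵥ ψ c₀) c) c (P.part c u) =
          (if c < c₀ then (-1 : ℂ) ^ (P.part c u).card else 1) * ψ c (P.part c u) := by
      intro c hc
      by_cases hlt : c < c₀
      · simp only [if_pos hlt]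
        exact parityOp_mulVec_apply (ψ c) (P.part c u)
      · simp only [if_neg hlt, Function.update_of_ne (Finset.ne_of_mem_erase hc), one_mul]
    rw [Finset.prod_congr rfl hfac, Finset.prod_mul_distrib, ← hrest]
    congr 1
    rw [Finset.prod_ite, Finset.prod_const_one, mul_one, Finset.prod_pow_eq_pow_sum, hn,
      P.card_env_filter_lt]
    congr 1
    refine Finset.sum_congr ?_ fun _ _ => rfl
    ext c
    simp only [Finset.mem_filter, Finset.mem_erase, Finset.mem_univ, true_and, and_true]
    exact ⟨fun h => ⟨ne_of_lt h, h⟩, fun h => h.2⟩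
  have hΨ : ∀ w : Finset κ, P.prodFamily ψ (combine (P.emb c₀) w (env (P.emb c₀) u)) =
      P.koszul (combine (P.emb c₀) w (env (P.emb c₀) u)) * (ψ c₀ w * rest) := by
    intro w
    rw [prodFamily_apply, ← Finset.mul_prod_erase _ _ (Finset.mem_univ c₀), P.part_combine_self]
    congr 2
    exact Finset.prod_congr rfl fun c hc => by rw [P.part_combine_of_ne (Finset.ne_of_mem_erase hc)]
  have hterm : ∀ w : Finset κ,
      a (pre (P.emb c₀) u) w * transSign (P.emb c₀) (env (P.emb c₀) u) (pre (P.emb c₀) u ∆ w) *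
          P.prodFamily ψ (combine (P.emb c₀) w (env (P.emb c₀) u)) =
        P.koszul u * (a (pre (P.emb c₀) u) w * ψ c₀ w) * ((-1) ^ n * rest) := by
    intro w
    by_cases h0 : a (pre (P.emb c₀) u) w = 0
    · rw [h0]; ring
    · have hodd : Odd ((pre (P.emb c₀) u).card + w.card) := by
        rw [Nat.odd_iff]; exact ha _ _ h0
      have hsign := P.koszul_combine_mul_koszul_combine c₀ (pre (P.emb c₀) u) w hr
      rw [hu, pow_mul, hodd.neg_one_pow, ← hn] at hsign
      have hk : P.koszul (combine (P.emb c₀) w (env (P.emb c₀) u)) =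
          P.koszul u * ((-1) ^ n * transSign (P.emb c₀) (env (P.emb c₀) u) (pre (P.emb c₀) u ∆ w)) := by
        rw [← hsign, ← mul_assoc, P.koszul_mul_self, one_mul]
      have ht : transSign (P.emb c₀) (env (P.emb c₀) u) (pre (P.emb c₀) u ∆ w) *
          transSign (P.emb c₀) (env (P.emb c₀) u) (pre (P.emb c₀) u ∆ w) = 1 := by
        rw [transSign_mul_transSign, symmDiff_self, Finset.bot_eq_empty, transSign_empty]
      rw [hΨ, hk]
      linear_combination (P.koszul u * a (pre (P.emb c₀) u) w * ψ c₀ w * (-1) ^ n * rest) * ht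
  rw [TwoCluster.jwEmbed_mulVec_apply, Finset.sum_congr rfl fun w _ => hterm w, ← Finset.sum_mul,
    ← Finset.mul_sum, hstring]
  rw [prodFamily_apply, ← Finset.mul_prod_erase _ _ (Finset.mem_univ c₀)]
  simp only [lt_irrefl, if_false, Function.update_self]
  rw [mul_assoc]
  rfl

/-- **`c_{emb c₀ i}` on a product state.** [cite: BratteliRobinsonII1997, §5.2.2 eq. (5.2.13)] -/
theorem annihilation_emb_mulVec_prodFamily [Fintype ι'] [Fintype C] [Fintype κ] [DecidableEq C]
    (c₀ : C) (i : κ) (ψ : C → Fock κ) :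
    annihilation (P.emb c₀ i) *ᵥ P.prodFamily ψ =
      P.prodFamily (fun c => if c < c₀ then parityOp *ᵥ ψ c else
        Function.update ψ c₀ (annihilation i *ᵥ ψ c₀) c) := by
  rw [← jwEmbed_annihilation]
  exact P.jwEmbed_mulVec_prodFamily_of_parityReversing (isParityReversing_annihilation i) c₀ ψ

/-- **`c†_{emb c₀ i}` on a product state.** [cite: BratteliRobinsonII1997, §5.2.2 eq. (5.2.13)] -/
theorem creation_emb_mulVec_prodFamily [Fintype ι'] [Fintype C] [Fintype κ] [DecidableEq C]
    (c₀ : C) (i : κ) (ψ : C → Fock κ) :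
    creation (P.emb c₀ i) *ᵥ P.prodFamily ψ =
      P.prodFamily (fun c => if c < c₀ then parityOp *ᵥ ψ c else
        Function.update ψ c₀ (creation i *ᵥ ψ c₀) c) := by
  rw [← jwEmbed_creation]
  exact P.jwEmbed_mulVec_prodFamily_of_parityReversing (isParityReversing_creation i) c₀ ψ

end Partition

end ClusterProduct

end Literature.MathematicalPhysics.QuantumLattice

end
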